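import Summits.FinalStateConjecture.FinalStateConjecture.Theorems.SwallowTheDatumKerrShieldedSettlesStubKerrVacuumAux15
import Literature.Geometry.Lorentzian.ChartMetricCoord
import HarnessLib

/-!
# Kerr is Ricci-flat, XII: the second derivatives of the Kerr–Schild quantities at a point

Support file for the stub `stub_kerrVacuum` of line `tapered-temporal-collar` (crux
`stmt-FinalStateConjecture-10054`). At a point `x` of `E4` with Kerr–Schild radius `r > 0` put
`c = Kerr.latitude a x = z/r`; then the defining quartic of `r` reads
`x₂² = (r² + a²)(1 − c²) − x₁²` (`rel_sq`), `Σ = r² + a²c²` (`blSigma_eq`), and the values at `x` of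
`H`, `ℓ_μ`, `ℓ^μ`, of the partial derivatives `∂_i r`, `∂_i H`, `∂_i ℓ_μ`, `∂_i∂_j r`, `∂_i∂_j H`,
`∂_i∂_j ℓ_μ` (prelude closed forms and `…StubKerrVacuumAux1`) and of `g_{μν}`, `∂_i g_{μν}`,
`∂_i∂_j g_{μν}` (product rule, `fderiv_fderiv_bilin`) are the closed-form tables of `…Aux2` at
`(a, M, x¹, x², r, c)`. Kerr–Schild 1965, §§2–3; Visser arXiv:0706.0622, (32)–(36).

## References

* R. P. Kerr, A. Schild (1965), §§2–3; M. Visser, arXiv:0706.0622, (32)–(36).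
-/

set_option linter.dupNamespace false
set_option maxSynthPendingDepth 3
set_option linter.unusedSimpArgs false
set_option linter.unusedTactic false
set_option linter.unreachableTactic false
set_option linter.unnecessarySeqFocus false

noncomputable section

open Set Filter
open scoped Topology
open Literature.Geometry.Lorentzian

namespace Summit.FinalStateConjecture.FinalStateConjecture.Theorems.SwallowTheDatum.KerrShieldedSettles

namespace StubKerrVacuum

variable {a : ℝ} {x : E4}

/-! ### Second derivatives at the point -/

set_option maxRecDepth 8192 in
set_option maxHeartbeats 4000000 in
/-- `∂_i ∂_j r` is the table value `d2rT i j`. [cite: arXiv07060622, (35)] -/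
theorem fderiv_fderiv_radius_eq_d2rT (M : ℝ) (hx : 0 < Kerr.radius a x) (i j : Fin 4) :
    fderiv ℝ (fun y ↦ fderiv ℝ (Kerr.radius a) y (E4.basisVector j)) x (E4.basisVector i) =
      d2rT a M (x 1) (x 2) (Kerr.radius a x) (Kerr.latitude a x) i j := by
  have hr := hx.ne'
  have hS := sig_ne_zero hx
  have hP := psq_ne_zero hx
  have hC := rel_sq hx
  rw [fderiv_fderiv_radius hx]
  simp only [fderiv_radius_eq_drT M hx, blSigma_eq hx, x3_eq hx]
  fin_cases i <;> fin_cases j <;> simp only [basisVector_eq_bvT, bvT, drT, d2rT, Fin.isValue] <;>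
    (field_simp <;> ring_nf <;> (try simp only [xp16 hC, xp15 hC, xp14 hC, xp13 hC, xp12 hC, xp11 hC,
      xp10 hC, xp9 hC, xp8 hC, xp7 hC, xp6 hC, xp5 hC, xp4 hC, xp3 hC, hC]) <;> (try ring_nf))

set_option maxRecDepth 8192 in
set_option maxHeartbeats 4000000 in
/-- `∂_i ∂_j H` is the table value `d2hT i j`. [cite: arXiv07060622, (33)] -/
theorem fderiv_fderiv_scalarH_eq_d2hT (M : ℝ) (hx : 0 < Kerr.radius a x) (i j : Fin 4) :
    fderiv ℝ (fun y ↦ fderiv ℝ (Kerr.scalarH M a) y (E4.basisVector j)) x (E4.basisVector i) =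
      d2hT a M (x 1) (x 2) (Kerr.radius a x) (Kerr.latitude a x) i j := by
  have hr := hx.ne'
  have hS := sig_ne_zero hx
  have hP := psq_ne_zero hx
  have hC := rel_sq hx
  rw [fderiv_fderiv_scalarH M hx]
  simp only [fderiv_fderiv_radius_eq_d2rT M hx, fderiv_radius_eq_drT M hx, blSigma_eq hx,
    x3_eq hx]
  fin_cases i <;> fin_cases j <;>
    simp only [basisVector_eq_bvT, bvT, drT, d2rT, d2hT, Fin.isValue] <;>
    (field_simp <;> ring_nf <;> (try simp only [xp16 hC, xp15 hC, xp14 hC, xp13 hC, xp12 hC, xp11 hC,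
      xp10 hC, xp9 hC, xp8 hC, xp7 hC, xp6 hC, xp5 hC, xp4 hC, xp3 hC, hC]) <;> (try ring_nf))

/-- `∂_i ∂_j ℓ₀ = 0`. [cite: arXiv07060622, (34)] -/
theorem fderiv_fderiv_nullCovectorFun_zero_eq (M : ℝ) (x : E4) (i j : Fin 4) :
    fderiv ℝ (fun y ↦ fderiv ℝ (fun z ↦ Kerr.nullCovectorFun a z 0) y (E4.basisVector j)) x
        (E4.basisVector i) = d2lT a M (x 1) (x 2) (Kerr.radius a x) (Kerr.latitude a x) 0 i j := by
  have h0 : (fun y ↦ fderiv ℝ (fun z ↦ Kerr.nullCovectorFun a z 0) y (E4.basisVector j)) =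
      fun _ ↦ (0 : ℝ) := by
    funext y
    have h1 : (fun z ↦ Kerr.nullCovectorFun a z 0) = fun _ ↦ (1 : ℝ) :=
      funext fun z ↦ Kerr.nullCovectorFun_apply_zero a z
    rw [h1]
    simp
  rw [h0]
  simp [d2lT]

set_option maxRecDepth 8192 in
set_option maxHeartbeats 4000000 in
/-- `∂_i ∂_j ℓ₁` is the table value `d2lT 1 i j`. [cite: arXiv07060622, (34)] -/
theorem fderiv_fderiv_nullCovectorFun_one_eq (M : ℝ) (hx : 0 < Kerr.radius a x) (i j : Fin 4) :
    fderiv ℝ (fun y ↦ fderiv ℝ (fun z ↦ Kerr.nullCovectorFun a z 1) y (E4.basisVector j)) x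
        (E4.basisVector i) = d2lT a M (x 1) (x 2) (Kerr.radius a x) (Kerr.latitude a x) 1 i j := by
  have hr := hx.ne'
  have hS := sig_ne_zero hx
  have hP := psq_ne_zero hx
  have hC := rel_sq hx
  rw [fderiv_fderiv_nullCovectorFun_one hx]
  simp only [fderiv_fderiv_radius_eq_d2rT M hx, fderiv_radius_eq_drT M hx, x3_eq hx]
  fin_cases i <;> fin_cases j <;>
    simp only [basisVector_eq_bvT, bvT, drT, d2rT, d2lT, d2l1T, Fin.isValue] <;>
    (field_simp <;> ring_nf <;> (try simp only [xp16 hC, xp15 hC, xp14 hC, xp13 hC, xp12 hC, xp11 hC,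
      xp10 hC, xp9 hC, xp8 hC, xp7 hC, xp6 hC, xp5 hC, xp4 hC, xp3 hC, hC]) <;> (try ring_nf))

set_option maxRecDepth 8192 in
set_option maxHeartbeats 4000000 in
/-- `∂_i ∂_j ℓ₂` is the table value `d2lT 2 i j`. [cite: arXiv07060622, (34)] -/
theorem fderiv_fderiv_nullCovectorFun_two_eq (M : ℝ) (hx : 0 < Kerr.radius a x) (i j : Fin 4) :
    fderiv ℝ (fun y ↦ fderiv ℝ (fun z ↦ Kerr.nullCovectorFun a z 2) y (E4.basisVector j)) x
        (E4.basisVector i) = d2lT a M (x 1) (x 2) (Kerr.radius a x) (Kerr.latitude a x) 2 i j := by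
  have hr := hx.ne'
  have hS := sig_ne_zero hx
  have hP := psq_ne_zero hx
  have hC := rel_sq hx
  rw [fderiv_fderiv_nullCovectorFun_two hx]
  simp only [fderiv_fderiv_radius_eq_d2rT M hx, fderiv_radius_eq_drT M hx, x3_eq hx]
  fin_cases i <;> fin_cases j <;>
    simp only [basisVector_eq_bvT, bvT, drT, d2rT, d2lT, d2l2T, Fin.isValue] <;>
    (field_simp <;> ring_nf <;> (try simp only [xp16 hC, xp15 hC, xp14 hC, xp13 hC, xp12 hC, xp11 hC,
      xp10 hC, xp9 hC, xp8 hC, xp7 hC, xp6 hC, xp5 hC, xp4 hC, xp3 hC, hC]) <;> (try ring_nf))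

set_option maxRecDepth 8192 in
set_option maxHeartbeats 4000000 in
/-- `∂_i ∂_j ℓ₃` is the table value `d2lT 3 i j`. [cite: arXiv07060622, (34)] -/
theorem fderiv_fderiv_nullCovectorFun_three_eq (M : ℝ) (hx : 0 < Kerr.radius a x) (i j : Fin 4) :
    fderiv ℝ (fun y ↦ fderiv ℝ (fun z ↦ Kerr.nullCovectorFun a z 3) y (E4.basisVector j)) x
        (E4.basisVector i) = d2lT a M (x 1) (x 2) (Kerr.radius a x) (Kerr.latitude a x) 3 i j := by
  have hr := hx.ne'
  have hS := sig_ne_zero hx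
  have hP := psq_ne_zero hx
  have hC := rel_sq hx
  rw [fderiv_fderiv_nullCovectorFun_three hx]
  simp only [fderiv_fderiv_radius_eq_d2rT M hx, fderiv_radius_eq_drT M hx, x3_eq hx]
  fin_cases i <;> fin_cases j <;>
    simp only [basisVector_eq_bvT, bvT, drT, d2rT, d2lT, d2l3T, Fin.isValue] <;>
    (field_simp <;> ring_nf <;> (try simp only [xp16 hC, xp15 hC, xp14 hC, xp13 hC, xp12 hC, xp11 hC,
      xp10 hC, xp9 hC, xp8 hC, xp7 hC, xp6 hC, xp5 hC, xp4 hC, xp3 hC, hC]) <;> (try ring_nf))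

/-- `∂_i ∂_j ℓ_μ` is the table value `d2lT μ i j`. [cite: arXiv07060622, (34)] -/
theorem fderiv_fderiv_nullCovectorFun_eq_d2lT (M : ℝ) (hx : 0 < Kerr.radius a x) (μ i j : Fin 4) :
    fderiv ℝ (fun y ↦ fderiv ℝ (fun z ↦ Kerr.nullCovectorFun a z μ) y (E4.basisVector j)) x
        (E4.basisVector i) = d2lT a M (x 1) (x 2) (Kerr.radius a x) (Kerr.latitude a x) μ i j := by
  fin_cases μ
  exacts [fderiv_fderiv_nullCovectorFun_zero_eq M x i j, fderiv_fderiv_nullCovectorFun_one_eq M hx i j,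
    fderiv_fderiv_nullCovectorFun_two_eq M hx i j, fderiv_fderiv_nullCovectorFun_three_eq M hx i j]

/-- **The second directional derivatives of the Kerr–Schild components**: differentiating
`∂_u g(∂_μ, ∂_ν) = 2 ∂_uH ℓ_μ ℓ_ν + 2H (∂_uℓ_μ ℓ_ν + ℓ_μ ∂_uℓ_ν)` (`Kerr.fderiv_bilin_basisVector`,
valid on the open set `{r > 0}`) along `t ↦ x + tv` gives the product-rule expansion of
`∂_v ∂_u g_{μν}` through `∂_v∂_uH`, `∂H`, `H`, `∂_v∂_uℓ`, `∂ℓ`, `ℓ`. [cite: KerrSchild1965, §2] -/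
theorem fderiv_fderiv_bilin (M : ℝ) (hx : 0 < Kerr.radius a x) (v u : E4) (μ ν : Fin 4) :
    fderiv ℝ (fun y ↦ fderiv ℝ (Kerr.bilin M a) y u (E4.basisVector μ) (E4.basisVector ν)) x v =
      2 * fderiv ℝ (fun y ↦ fderiv ℝ (Kerr.scalarH M a) y u) x v * Kerr.nullCovectorFun a x μ *
            Kerr.nullCovectorFun a x ν +
          2 * fderiv ℝ (Kerr.scalarH M a) x u *
            (fderiv ℝ (fun z ↦ Kerr.nullCovectorFun a z μ) x v * Kerr.nullCovectorFun a x ν +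
              Kerr.nullCovectorFun a x μ * fderiv ℝ (fun z ↦ Kerr.nullCovectorFun a z ν) x v) +
        2 * fderiv ℝ (Kerr.scalarH M a) x v *
            (fderiv ℝ (fun z ↦ Kerr.nullCovectorFun a z μ) x u * Kerr.nullCovectorFun a x ν +
              Kerr.nullCovectorFun a x μ * fderiv ℝ (fun z ↦ Kerr.nullCovectorFun a z ν) x u) +
          2 * Kerr.scalarH M a x *
            (fderiv ℝ (fun y ↦ fderiv ℝ (fun z ↦ Kerr.nullCovectorFun a z μ) y u) x v *
                  Kerr.nullCovectorFun a x ν +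
                fderiv ℝ (fun z ↦ Kerr.nullCovectorFun a z μ) x u *
                  fderiv ℝ (fun z ↦ Kerr.nullCovectorFun a z ν) x v +
              (fderiv ℝ (fun z ↦ Kerr.nullCovectorFun a z μ) x v *
                  fderiv ℝ (fun z ↦ Kerr.nullCovectorFun a z ν) x u +
                Kerr.nullCovectorFun a x μ *
                  fderiv ℝ (fun y ↦ fderiv ℝ (fun z ↦ Kerr.nullCovectorFun a z ν) y u) x v)) := by
  -- differentiability of the component function
  have hcont : ContDiffAt ℝ 2 (Kerr.bilin M a) x := Kerr.contDiffAt_bilin M a hx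
  have hD2 : DifferentiableAt ℝ (fderiv ℝ (Kerr.bilin M a)) x :=
    (hcont.fderiv_right (m := 1) le_rfl).differentiableAt one_ne_zero
  have hd : DifferentiableAt ℝ
      (fun y ↦ fderiv ℝ (Kerr.bilin M a) y u (E4.basisVector μ) (E4.basisVector ν)) x :=
    ((hD2.clm_apply (differentiableAt_const u)).clm_apply (differentiableAt_const _)).clm_apply
      (differentiableAt_const _)
  have h1 : HasLineDerivAt ℝ
      (fun y ↦ fderiv ℝ (Kerr.bilin M a) y u (E4.basisVector μ) (E4.basisVector ν))
      (fderiv ℝ (fun y ↦ fderiv ℝ (Kerr.bilin M a) y u (E4.basisVector μ) (E4.basisVector ν)) x v)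
      x v := hd.hasFDerivAt.hasLineDerivAt _
  refine h1.unique ?_
  show HasDerivAt (fun t : ℝ ↦
    fderiv ℝ (Kerr.bilin M a) (x + t • v) u (E4.basisVector μ) (E4.basisVector ν)) _ 0
  -- line derivatives of the atoms
  have hH : HasDerivAt (fun t : ℝ ↦ Kerr.scalarH M a (x + t • v))
      (fderiv ℝ (Kerr.scalarH M a) x v) 0 :=
    ((Kerr.contDiffAt_scalarH M a hx (n := 1)).differentiableAt one_ne_zero).hasFDerivAt.hasLineDerivAt v
  have hdH : HasDerivAt (fun t : ℝ ↦ fderiv ℝ (Kerr.scalarH M a) (x + t • v) u)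
      (fderiv ℝ (fun y ↦ fderiv ℝ (Kerr.scalarH M a) y u) x v) 0 :=
    (differentiableAt_fderiv_scalarH_apply M hx u).hasFDerivAt.hasLineDerivAt v
  have hL : ∀ κ : Fin 4, HasDerivAt (fun t : ℝ ↦ Kerr.nullCovectorFun a (x + t • v) κ)
      (fderiv ℝ (fun z ↦ Kerr.nullCovectorFun a z κ) x v) 0 := fun κ ↦
    ((Kerr.contDiffAt_nullCovectorFun a hx (n := 1) κ).differentiableAt
      one_ne_zero).hasFDerivAt.hasLineDerivAt v
  have hdL : ∀ κ : Fin 4, HasDerivAt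
      (fun t : ℝ ↦ fderiv ℝ (fun z ↦ Kerr.nullCovectorFun a z κ) (x + t • v) u)
      (fderiv ℝ (fun y ↦ fderiv ℝ (fun z ↦ Kerr.nullCovectorFun a z κ) y u) x v) 0 := fun κ ↦
    (differentiableAt_fderiv_nullCovectorFun_apply hx κ u).hasFDerivAt.hasLineDerivAt v
  have hev : (fun t : ℝ ↦
      fderiv ℝ (Kerr.bilin M a) (x + t • v) u (E4.basisVector μ) (E4.basisVector ν)) =ᶠ[𝓝 0]
      fun t ↦ 2 * (fderiv ℝ (Kerr.scalarH M a) (x + t • v) u *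
          Kerr.nullCovectorFun a (x + t • v) μ * Kerr.nullCovectorFun a (x + t • v) ν) +
        2 * (Kerr.scalarH M a (x + t • v) *
          (fderiv ℝ (fun z ↦ Kerr.nullCovectorFun a z μ) (x + t • v) u *
              Kerr.nullCovectorFun a (x + t • v) ν +
            Kerr.nullCovectorFun a (x + t • v) μ *
              fderiv ℝ (fun z ↦ Kerr.nullCovectorFun a z ν) (x + t • v) u)) := by
    filter_upwards [Kerr.eventually_radius_line_pos hx v] with t ht
    rw [Kerr.fderiv_bilin_basisVector M a ht u μ ν]
    ring
  have hG := (((hdH.mul (hL μ)).mul (hL ν)).const_mul 2).add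
    ((hH.mul ((((hdL μ).mul (hL ν))).add ((hL μ).mul (hdL ν)))).const_mul 2)
  refine (hG.congr_of_eventuallyEq hev).congr_deriv ?_
  simp only [Pi.mul_apply, Pi.add_apply, zero_smul, add_zero]
  ring

/-- `∂_i ∂_j g(∂_μ, ∂_ν)`, as the derivative of the component function `y ↦ ∂_j g(∂_μ,∂_ν)(y)`, is
the product-rule value `d2gT i j μ ν`. [cite: KerrSchild1965, §2] -/
theorem fderiv_fderiv_bilin_eq_d2gT (M : ℝ) (hx : 0 < Kerr.radius a x) (i j μ ν : Fin 4) :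
    fderiv ℝ (fun y ↦ fderiv ℝ (Kerr.bilin M a) y (E4.basisVector j) (E4.basisVector μ)
        (E4.basisVector ν)) x (E4.basisVector i) =
      d2gT a M (x 1) (x 2) (Kerr.radius a x) (Kerr.latitude a x) i j μ ν := by
  rw [fderiv_fderiv_bilin M hx, fderiv_fderiv_scalarH_eq_d2hT M hx, fderiv_scalarH_eq_dhT M hx,
    fderiv_scalarH_eq_dhT M hx, fderiv_fderiv_nullCovectorFun_eq_d2lT M hx,
    fderiv_fderiv_nullCovectorFun_eq_d2lT M hx, fderiv_nullCovectorFun_eq_dlT M hx,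
    fderiv_nullCovectorFun_eq_dlT M hx, fderiv_nullCovectorFun_eq_dlT M hx,
    fderiv_nullCovectorFun_eq_dlT M hx, scalarH_eq_hT M hx, nullCovectorFun_eq_ellT M x μ,
    nullCovectorFun_eq_ellT M x ν, d2gT]
  ring

end StubKerrVacuum

/-- **Registered sub-goal `stub_kerrVacuumD2Metric`** of stub `stub_kerrVacuum` (line
`tapered-temporal-collar`): the second partial derivatives of the Kerr–Schild components at a point
with `r > 0` are the closed-form table `d2gT` at `(a, M, x¹, x², r, z/r)`.
[cite: KerrSchild1965, §2] -/
theorem stub_kerrVacuumD2Metric : ∀ (a M : ℝ) (x : E4), 0 < Kerr.radius a x → ∀ (i j μ ν : Fin 4),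
    fderiv ℝ (fun y ↦
    fderiv ℝ (Kerr.bilin M a) y (E4.basisVector j) (E4.basisVector μ) (E4.basisVector ν)) x
    (E4.basisVector i)
    = StubKerrVacuum.d2gT a M (x 1) (x 2) (Kerr.radius a x) (Kerr.latitude a x) i j μ ν :=
  fun _ M _ hx i j μ ν ↦ StubKerrVacuum.fderiv_fderiv_bilin_eq_d2gT M hx i j μ ν

end Summit.FinalStateConjecture.FinalStateConjecture.Theorems.SwallowTheDatum.KerrShieldedSettles

end
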